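/-
Copyright (c) 2026 the pub-hodgecm-mathlib formalisation cell (harness21).  Prover seat hodgecm-mathlib-K2Liu-p11 (g0): Track B «K2-LIT»,
#184♮ = hLiu418 = stmt-HodgeConjecture-24832; socket #33b `sig_K2LiuSiegelBigCellSection` of `Cruxes/HLiu418/Lines/K2_Liu_CurveThetaSigs_U5d_ZetaS.lean`
(U5d ED. 8 :711) — THE PAYER BY VALUE (LEAD F0P6-plan (g11) RE-DEAL #33b (D) 2026-09-04T05:43:59Z «CLOSER `Theorems/K2LiuSiegelBigCellSection.lean ::
siegelBigCellSection : ‹#33b U5d ED. 8 :711 VERBATIM›»; LEAD F0P6-plan (g12) 06:17:21Z).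
-/
import Summits.HodgeConjecture.HodgeConjecture.Theorems.K2LiuSiegelBigCellSectionOfLocal      -- ★ the closer modulo the one-place packages (K2Liu-p11)
import Summits.HodgeConjecture.HodgeConjecture.Theorems.K2LiuSiegelMainOrbitArchSection      -- ★ p857853 (D-arch) `archSectionPackage` (K2Liu-p10)
import Summits.HodgeConjecture.HodgeConjecture.Theorems.K2LiuSiegelMainOrbitLocalSection     -- ★ p857795 (D-fin)+(D2) `exists_siegel_localSection_package` (K2Liu-p08)
import HarnessLib

/-!
# Crux `HLiu418`, road `K2_Liu`, unit U5d «`Z_S`», socket #33b — GOOD SECTIONS SUPPORTED IN THE MAIN ORBIT EXIST (the payer by value)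

Cell `hodgecm-mathlib`, crux item hLiu418 = `stmt-HodgeConjecture-24832`, route of record `HCCMUnconditional`; squad K2 ∕ K2Liu, LEAD F0P6-plan,
prover K2Liu-p11 (g0).  ONE THEOREM (no `def`, no instance, no notation, no named-fact hypothesis, no `sorry`); lane
`--supports stmt-HodgeConjecture-24832 --as helper` — the socket #33b is TIED to this theorem by the typist's U5d ED. 9 (`:= siegelBigCellSection`), not here.

`siegelBigCellSection : ‹#33b U5d ED. 8 :711 VERBATIM›` := ★ `K2LiuSiegelBigCellSectionOfLocal.siegelBigCellSection_of_localPackages` («#33b FOLLOWS FROM ITS ONE-PLACE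
SECTION PACKAGES») fed BY NAME with the archimedean package ★ `K2LiuSiegelMainOrbitArchSection.archSectionPackage` (K2Liu-p10: the archimedean main-orbit chart is
an open embedding with closed image of `P_Δ·ι(C,1)`, Urysohn bump, `δ_∞ ⊗ g_∞` continued by `0`) and the finite packages ★
`K2LiuSiegelMainOrbitLocalSection.exists_siegel_localSection_package` (K2Liu-p08: the `p`-adic main-orbit chart, compact-open bump, locally constant `δ_v ⊗ g_v`, open
stabiliser).  Organ map of #33b: (a) main-orbit topology ★ p857705∕p857760∕p857744 · (b) unramified vectors ★ `LambdaLoc` · (c) restricted product ★ p857608∕p857623∕p857633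
· (d) weight and positivity ★ `K2LiuSiegelBigCellSectionOfLocalPrelims.integral_tensor_bump_pos`.
[GelbartPiatetskishapiroRallis1987, Part A §6]; [KudlaRallis1994, §1]; [HarrisKudlaSweet1996, §6 (6.27)–(6.28) p. 973]; [Liu2011, §2C (2-5) pp. 863–864]; [Tan1999, §1].
HONEST LABEL: HC_CM is proved only modulo the 7 printed citations (2 remaining named inputs: hLiu418 = stmt-HodgeConjecture-24832,
h413 = stmt-HodgeConjecture-24833) until rung 0 closes; this file pays socket #33b only once the typist ties it (U5d ED. 9); count-neutral until then.
-/

set_option autoImplicit false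
set_option linter.dupNamespace false

noncomputable section

open scoped Matrix RestrictedProduct
open Filter Topology Set MeasureTheory NumberField IsDedekindDomain NumberField.mixedEmbedding
open Literature.NumberTheory.Automorphic Literature.NumberTheory.Automorphic.UnitaryGroup Literature.NumberTheory.GaloisRepresentations
open Literature.NumberTheory.GelbartRogawski1991 Literature.NumberTheory.GelbartRogawski1991.GRConstruction
open Literature.NumberTheory.K2Lit.SiegelDoubled Literature.NumberTheory.K2Lit.PlaceSplitting

namespace Summit.HodgeConjecture.HodgeConjecture.Cruxes.HLiu418.K2LiuSiegelBigCellSection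

/-- **#33b «GOOD SECTIONS SUPPORTED IN THE MAIN ORBIT EXIST»** — statement = socket `sig_K2LiuSiegelBigCellSection` (U5d ED. 8 :711) VERBATIM: for a Hecke character `χ`
unramified off `S`, any `s₀` and any open `U ∋ 1` of `G_∞ × G_S` there are open levels `K′_v` (`v ∈ S`), a continuous Siegel section `φ♭ ∈ I(s₀, χ)` on `H(𝔸)`
right-invariant under `K^S_H · ∏_{v∈S} K′_v`, and a weight `g ≥ 0` with `φ♭(ι(ιA x, 1)) = g(x)`, `supp g ⊆ U`, `∫ g > 0`.  Proof = ★ `siegelBigCellSection_of_localPackages`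
at the ★ (D-arch) and ★ (D-fin) heads. [cite: GelbartPiatetskishapiroRallis1987, Part A §6] [cite: KudlaRallis1994, §1] [cite: HarrisKudlaSweet1996, §6 (6.27)–(6.28) p. 973]
[cite: Liu2011, §2C (2-5) pp. 863–864] [cite: Tan1999, §1] -/
theorem siegelBigCellSection :
    ∀ (L : Type) [Field L] [NumberField L] [IsCMField L] {N n : ℕ} (e : Fin N × Fin 1 ≃ Fin n)
      (dV : Fin N → L) (hdV : ∀ i, IsCMField.complexConj L (dV i) = dV i) (_hdV0 : ∀ i, dV i ≠ 0)
      (dW : Fin 1 → L) (hdW : ∀ i, IsCMField.complexConj L (dW i) = dW i) (_hdW0 : ∀ i, dW i ≠ 0)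
      (H : Matrix (Fin N) (Fin N) L)
      (t : L) (_ht : t ≠ 0) (g : GL (Fin N) L)
      (_hg : formCongr ((IsCMField.complexConj L : L ≃ₐ[↥(maximalRealSubfield L)] L) : L →+* L) g (t • H) = Matrix.diagonal dV)
      (ιA : (UnitaryGroup.adelicGroupData (Fp L) L (IsCMField.complexConj L) N H).Adelic →*
        UnitaryGroup.adelic (Fp L) L (IsCMField.complexConj L) N (Matrix.diagonal dV))
      (_hιA : ∀ k, ((ιA k : ↥(UnitaryGroup.adelic (Fp L) L (IsCMField.complexConj L) N (Matrix.diagonal dV))) :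
            GL (Fin N) (AdeleRing (𝓞 L) L)) =
          (toAdeleGL L g)⁻¹ * UnitaryGroup.adelicVal (Fp L) L (IsCMField.complexConj L) N H k * toAdeleGL L g)
      (S : Finset (HeightOneSpectrum (𝓞 (Fp L)))) [DecidableEq (HeightOneSpectrum (𝓞 (Fp L)))]
      [MeasurableSpace (UnitaryGroup.arch (Fp L) L (IsCMField.complexConj L) N H)]
      [BorelSpace (UnitaryGroup.arch (Fp L) L (IsCMField.complexConj L) N H)]
      [∀ v : HeightOneSpectrum (𝓞 (Fp L)), MeasurableSpace (UnitaryGroup.localPi L (IsCMField.complexConj L) N H v)]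
      [∀ v : HeightOneSpectrum (𝓞 (Fp L)), BorelSpace (UnitaryGroup.localPi L (IsCMField.complexConj L) N H v)]
      (νinf : Measure (UnitaryGroup.arch (Fp L) L (IsCMField.complexConj L) N H)) [νinf.IsHaarMeasure]
      (νS : ∀ v : S, Measure (UnitaryGroup.localPi L (IsCMField.complexConj L) N H v.1)) [∀ v, (νS v).IsHaarMeasure]
      (χ : HeckeCharacter L) (_hχ : ∀ v, v ∉ S → ∀ w' : UnitaryGroup.PlacesOver L v, χ.IsUnramifiedAt w'.1)
      (s₀ : ℂ)
      (U : Set (UnitaryGroup.arch (Fp L) L (IsCMField.complexConj L) N H ×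
        (Π v : S, UnitaryGroup.localPi L (IsCMField.complexConj L) N H v.1)))
      (_hU : IsOpen U) (_h1 : (1 : UnitaryGroup.arch (Fp L) L (IsCMField.complexConj L) N H ×
        (Π v : S, UnitaryGroup.localPi L (IsCMField.complexConj L) N H v.1)) ∈ U),
    ∃ (K' : ∀ v : S, Subgroup (UnitaryGroup.localPi L (IsCMField.complexConj L) (n + n) (hermD L e dV hdV dW hdW) v.1))
      (φb : HA L e dV hdV dW hdW → ℂ)
      (g : UnitaryGroup.arch (Fp L) L (IsCMField.complexConj L) N H ×
        (Π v : S, UnitaryGroup.localPi L (IsCMField.complexConj L) N H v.1) → ℝ),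
      (∀ v : S, IsOpen (K' v : Set (UnitaryGroup.localPi L (IsCMField.complexConj L) (n + n) (hermD L e dV hdV dW hdW) v.1))) ∧
      IsSiegelDeltaSection L e dV hdV dW hdW χ s₀ φb ∧ Continuous φb ∧
      (∀ h k : HA L e dV hdV dW hdW,
        UnitaryGroup.archPart (Fp L) L (IsCMField.complexConj L) (n + n) (hermD L e dV hdV dW hdW) k = 1 →
        (∀ v, v ∉ S → UnitaryGroup.evalPlace (Fp L) L (IsCMField.complexConj L) (n + n) (hermD L e dV hdV dW hdW) v
            (UnitaryGroup.finPart (Fp L) L (IsCMField.complexConj L) (n + n) (hermD L e dV hdV dW hdW) k) ∈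
          UnitaryGroup.localInt L (IsCMField.complexConj L) (n + n) (hermD L e dV hdV dW hdW) v) →
        (∀ v : S, UnitaryGroup.evalPlace (Fp L) L (IsCMField.complexConj L) (n + n) (hermD L e dV hdV dW hdW) v.1
            (UnitaryGroup.finPart (Fp L) L (IsCMField.complexConj L) (n + n) (hermD L e dV hdV dW hdW) k) ∈ K' v) →
        φb (h * k) = φb h) ∧
      (∀ x, φb (iotaLeft L e dV hdV dW hdW (ιA (placesEmbed L H S x))) = ((g x : ℝ) : ℂ)) ∧
      0 ≤ g ∧ Function.support g ⊆ U ∧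
      0 < ∫ x, g x ∂(νinf.prod (Measure.pi νS)) := by
  intro L _ _ _ N n e dV hdV hdV0 dW hdW hdW0 H t ht g hg ιA hιA S _ _ _ _ _ νinf _ νS _ χ hχ s₀ U hU h1
  exact K2LiuSiegelBigCellSectionOfLocal.siegelBigCellSection_of_localPackages L e dV hdV hdV0 dW hdW hdW0 H t ht g hg ιA hιA S νinf νS χ hχ s₀ U hU h1
    (K2LiuSiegelMainOrbitArchSection.archSectionPackage L e dV hdV dW hdW hdV0 hdW0 χ s₀)
    (fun v Uv hUo h1v => K2LiuSiegelMainOrbitLocalSection.exists_siegel_localSection_package L e dV hdV dW hdW v.1 hdV0 hdW0 χ s₀ Uv hUo h1v)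

end Summit.HodgeConjecture.HodgeConjecture.Cruxes.HLiu418.K2LiuSiegelBigCellSection

end
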